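import Summits.QuantumFields.YangMills.Theorems.IR.AfPincerUcTypCriterion
import Summits.QuantumFields.YangMills.Theorems.IR.Negative.OnsetUcFalseOfMonopoleWire
import Summits.QuantumFields.YangMills.Theorems.IR.Negative.OnsetFormatsUcTransfer
import Summits.QuantumFields.YangMills.Theorems.IR.Negative.OnsetMixingFalseOfUniformWire
import Summits.QuantumFields.YangMills.Theorems.IR.Negative.AfOnsetUcFalseOfLateOnset
import HarnessLib

/-!
# Crux `IR` (stmt-QuantumFields-19354), line `af-pincer-Uc` (slot d9d9d710e4ae01bd): the SHARP ONSET currency I♯_SC, its glue to the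
# route decl (E discharged), the universal twin and its wire exposure, the abstract activity-supplier shapes, the δ-uniform trap

SOURCE TEXT: crux-plan desk `ym-cplan-19354-af-pincer` port rev 2 `pub/ym-beyond/ym-cplan-19354-af-pincer/port/AfPincerUcSharpOnset.lean`
sha16 71577857bd55b2bd (owner filing map R99, 2026-08-27T11:42:46Z).  Helper module for item `stmt-QuantumFields-19354`
(`--supports stmt-QuantumFields-19354 --as helper`; it closes nothing).

* `OnsetSharpUKPcSC` (**I♯_SC**, owner R95's typed target for the width lanes): on the simply connected family, for every `(G, r)` and positive unit map
  `a → 0` with `LowerBounds G r a`, some admissible `(n, ε)` such that for every rarity budget `δ > 0` the format `TypShellCondUKPc` holds, for all large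
  `β`, at SOME mesh `b ≥ 1` with `a β · b < T` (typical mixing AT scale `1/a`).  `IRNSC` = the slot's residual `stub_irNSC` type verbatim.
* `onsetSharpSC_of_onsetSC_af` (I_SC ∧ X ⇒ I♯_SC), `irCal_of_sharpUcSC`, `ir_of_onsetSharpSC : OnsetSharpUKPcSC → IRNSC → Theses.BalabanLadder.IR` (engine stub
  `AfPincerUc.stub_typCriterionUc` landed, p524017), `ir_of_onsetSC_af` (the registered pair's composition).
* universal twin `UnivOnsetSharpSC` ⇒ I♯_SC (`onsetSharpSC_of_univ`, class `Typ ≡ univ`) ⇒ `IR` (`ir_of_univOnsetSharpSC`); EXPOSURE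
  `not_univOnsetSharpSC_of_uniformWire` (`OnsetWire.onsetMixingAt_false_of_uniformWire`; `SimplyConnectedSpace G` explicit).
* (6d) `ir_of_activitySupplierHereditarySharpSC`: lane (1)B's relativised blocked-activity supplier in the FORMAT'S OWN hereditary currency, abstract — ANY per-frame
  activity predicate `Act`, an adapter `Act … Typ → ClauseIAll … Typ`, and a sharp construction statement supplying `TypLocal ∧ Act ∧ ClauseIIukp ∧ ClauseIII`
  per frame ⇒ `IR|SC` (no X-stub).  The working-class instance and the supplier-side reductions (6a)–(6c) live in `AfPincerUcSharpOnsetSuppliers`.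
* (6e) the δ-UNIFORM trap: `DeltaUniformOnsetSharpSC → UnivOnsetSharpSC` (inertness `OnsetFormatsUc.forall_typShellCondUKPc_iff_univShellCond`) and
  `not_deltaUniformOnsetSharpSC_of_uniformWire` — a typical-currency supplier serving every `δ` at a δ-independent mesh has proved the universal currency.
* §5 the K-SM∞ hook of record ON THE I♯ SIDE, in p528589's currency BY NAME (`AfPincerUc.LateOnsetAt`, cdisprove-afonset; owner R100): late onset at EVERY
  admissible `(n, ε)` of one `(G, r, a)` (for some budget `δ > 0` each) refutes I♯_SC — `not_onsetSharpUKPcSC_of_lateOnsetAt`.  (`AfPincerUc.KSMInf` itself, «∃ (n, ε, δ)», kills X =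
  `AFToOnsetUKPc` (`not_afToOnsetUKPc_of_ksmInf`) but NOT I♯_SC, whose supplier chooses `(n, ε)`: the quantifier placement is the whole difference.)  Plus the one non-overlapping
  lemma of the port's §6f, `mixOnsetUc_le_of_univShellCond`: the UNIVERSAL onset dominates every typical onset, so a late onset argued from uniform boundary data is K-UW territory.

PLACEMENT (ctriage-1 O-107, S91 870971a55b69c8b5): classes certified for EVERY exterior, and the working class of record, are kernel-invisible; as a STATEMENT
I♯_SC (`∃ Typ` free, clause (ii) hereditary) is strictly weaker than its universal twin, and (6d) is the shape in which a boundary-layer-sensitive class can enter.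

HONEST FRAMING: typed statements and implications among OPEN statements (plus negatives MODULO an unconstructed wire or an onset-divergence
hypothesis) for stubs of a CONDITIONAL chain; nothing here proves weak-coupling mixing or a gap; not Clay.  No `sorry`; axioms ⊆ {propext,
Classical.choice, Quot.sound}.
-/

set_option autoImplicit false

noncomputable section

open Filter Topology MeasureTheory
open scoped SchwartzMap
open Literature.MathematicalPhysics.QuantumFieldTheory Literature.MathematicalPhysics.QuantumLattice
open Summit.QuantumFields.YangMills.Cruxes.OSLegsFromFemtoAndGap.DlrCollarTransfer (GapInUnits LowerBounds Q2)
open Summit.QuantumFields.YangMills.Cruxes.IR.OnsetFormats (shellCount UnivShellCond)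

namespace Summit.QuantumFields.YangMills.Cruxes.IR.AfPincerUc.SharpOnset

open Summit.QuantumFields.YangMills.Cruxes.IR.AfPincerUc


/-! ## §1 I♯_SC, the residual, and the glue to `IRCal` (E as a hypothesis) and to the route decl -/

/-- The residual clause on the NON-simply-connected family (type of the registered `stub_irNSC`, verbatim). -/
def IRNSC : Prop :=
  ∀ (G : Type) [Group G] [TopologicalSpace G] [IsTopologicalGroup G] [CompactSpace G],
    IsCompactSimpleLieGroup G → ¬ SimplyConnectedSpace G →
    letI : MeasurableSpace G := borel G; haveI : BorelSpace G := ⟨rfl⟩;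
    ∀ (r : LatticeRep G) (a : ℝ → ℝ), (∀ β, 0 < a β) → Tendsto a atTop (𝓝 0) →
      LowerBounds G r a → GapInUnits G r a

/-- **I♯_SC** — `OnsetSharpUKPc` on the simply connected family. -/
def OnsetSharpUKPcSC : Prop :=
  ∀ (G : Type) [Group G] [TopologicalSpace G] [IsTopologicalGroup G] [CompactSpace G],
    IsCompactSimpleLieGroup G → SimplyConnectedSpace G →
    letI : MeasurableSpace G := borel G; haveI : BorelSpace G := ⟨rfl⟩;
    ∀ (r : LatticeRep G) (a : ℝ → ℝ), (∀ β, 0 < a β) → Tendsto a atTop (𝓝 0) → LowerBounds G r a →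
      ∃ (n : ℕ) (ε : ℝ), 1 ≤ n ∧ 0 ≤ ε ∧ ε * OnsetFormats.shellCount n ≤ 3 / 4 ∧
        ∀ δ : ℝ, 0 < δ → ∃ T β₂ : ℝ, ∀ β : ℝ, β₂ ≤ β →
          ∃ b : ℕ, 1 ≤ b ∧ a β * (b : ℝ) < T ∧ TypShellCondUKPc r.ρ β b n ε δ

/-- **I_SC ∧ X ⇒ I♯_SC (PROVED)** — the registered pair (`stub_onsetUcSC`, `stub_afOnsetUc`) exhibits the format at a mesh
`< T / a(β)` on the simply connected family (mirror constant bridged by `typShellCondUKPc_iff_mirror`). -/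
theorem onsetSharpSC_of_onsetSC_af (hI : OnsetFormatsUc.OnsetMixingTypicalUKPcSC) (hX : AFToOnsetUKPc) :
    OnsetSharpUKPcSC := by
  intro G _ _ _ _ hG hsc
  letI : MeasurableSpace G := borel G
  haveI : BorelSpace G := ⟨rfl⟩
  intro r a ha _ hlb
  obtain ⟨n, ε, hn, hε, hM, hIδ⟩ := hI G hG hsc r
  refine ⟨n, ε, hn, hε, hM, fun δ hδ => ?_⟩
  obtain ⟨β₂, hon⟩ := hIδ δ hδ
  obtain ⟨T, β₆, hpin⟩ :=
    fmtOnset_pinned (fun β' b => TypShellCondUKPc r.ρ β' b n ε δ) r a ha hlb (hX G hG r n ε hn hε hM δ hδ)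
  refine ⟨T, max β₂ β₆, fun β hβ => ?_⟩
  have hβ2 : β₂ ≤ β := le_trans (le_max_left _ _) hβ
  have hβ6 : β₆ ≤ β := le_trans (le_max_right _ _) hβ
  have hne : (fmtSet (fun β' b => TypShellCondUKPc r.ρ β' b n ε δ) β).Nonempty := by
    obtain ⟨b, hb, hP⟩ := hon β hβ2
    exact ⟨b, hb, (typShellCondUKPc_iff_mirror r.ρ β b n ε δ).mpr hP⟩
  obtain ⟨hb1, hP1⟩ := fmtOnset_spec (fun β' b => TypShellCondUKPc r.ρ β' b n ε δ) β hne
  exact ⟨_, hb1, hpin β hβ6, hP1⟩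

/-- **E ∧ I♯_SC ∧ R_NSC ⇒ IRCal (PROVED; no X)**, by cases on `SimplyConnectedSpace G`. -/
theorem irCal_of_sharpUcSC (hE : TypCriterionUKPc) (hS : OnsetSharpUKPcSC) (hN : IRNSC) : IRCal := by
  intro G _ _ _ _ hG
  letI : MeasurableSpace G := borel G
  haveI : BorelSpace G := ⟨rfl⟩
  intro r a ha hat hlb
  by_cases hsc : SimplyConnectedSpace G
  · obtain ⟨n, ε, hn, hε, hM, h⟩ := hS G hG hsc r a ha hat hlb
    obtain ⟨δ₀, κ, s₀, hδ₀, hκ, hcl⟩ := fmtClustering_of_typCriterionUKPc hE r hn hε hM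
    obtain ⟨T, β₂, hb⟩ := h δ₀ hδ₀
    refine gapInUnits_of_fmtOnset r a ha hκ hcl (β₂ := β₂) (T := T) (β₆ := β₂) ?_ ?_
    · intro β hβ
      obtain ⟨b, hb1, -, hP⟩ := hb β hβ
      exact ⟨b, hb1, hP⟩
    · intro β hβ
      obtain ⟨b, hb1, hlt, hP⟩ := hb β hβ
      have hle : fmtOnset (fun β' b => TypShellCondUKPc r.ρ β' b n ε δ₀) β ≤ b :=
        fmtOnset_le (fun β' b => TypShellCondUKPc r.ρ β' b n ε δ₀) β hb1 hP
      have hle' : (fmtOnset (fun β' b => TypShellCondUKPc r.ρ β' b n ε δ₀) β : ℝ) ≤ (b : ℝ) := by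
        exact_mod_cast hle
      calc a β * (fmtOnset (fun β' b => TypShellCondUKPc r.ρ β' b n ε δ₀) β : ℝ) ≤ a β * (b : ℝ) := by
            gcongr; exact (ha β).le
        _ < T := hlt
  · exact hN G hG hsc r a ha hat hlb

/-- **I♯_SC ∧ R_NSC ⇒ IR (PROVED, E discharged by p524017)** — route decl BY NAME. -/
theorem ir_of_onsetSharpSC (hS : OnsetSharpUKPcSC) (hN : IRNSC) :
    Summit.QuantumFields.YangMills.Theses.BalabanLadder.IR := by
  have hI : IRCal := irCal_of_sharpUcSC stub_typCriterionUc hS hN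
  delta Summit.QuantumFields.YangMills.Theses.BalabanLadder.IR
  delta Summit.QuantumFields.YangMills.Cruxes.IR.AfPincerUc.IRCal at hI
  exact hI

/-- **The registered pair closes the crux with E discharged (PROVED):** `stub_onsetUcSC`-type ∧ `stub_afOnsetUc`-type ∧ residual ⇒ `IR`
(same content as the slot's `IR_of_stubsUcSC` with `stub_typCriterionUc` supplied; here factored through I♯_SC). -/
theorem ir_of_onsetSC_af (hI : OnsetFormatsUc.OnsetMixingTypicalUKPcSC) (hX : AFToOnsetUKPc) (hN : IRNSC) :
    Summit.QuantumFields.YangMills.Theses.BalabanLadder.IR :=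
  ir_of_onsetSharpSC (onsetSharpSC_of_onsetSC_af hI hX) hN


/-! ## §2 The universal twin and its exposure (negative MODULO `OnsetWire.UniformWire`) -/

/-- **(1)B-sharp, universal currency, units-`a` form (SC family)** — «for all large `β` some universal certifying mesh `b` with
`a(β) · b < T`», `LowerBounds G r a` among the binders (it pins `1/a ≍ ξ_lat`). -/
def UnivOnsetSharpSC : Prop :=
  ∀ (G : Type) [Group G] [TopologicalSpace G] [IsTopologicalGroup G] [CompactSpace G],
    IsCompactSimpleLieGroup G → SimplyConnectedSpace G →
    letI : MeasurableSpace G := borel G; haveI : BorelSpace G := ⟨rfl⟩;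
    ∀ (r : LatticeRep G) (a : ℝ → ℝ), (∀ β, 0 < a β) → Tendsto a atTop (𝓝 0) → LowerBounds G r a →
      ∃ (n : ℕ) (ε : ℝ), 1 ≤ n ∧ 0 ≤ ε ∧ ε * shellCount n ≤ 3 / 4 ∧
        ∃ T β₂ : ℝ, ∀ β : ℝ, β₂ ≤ β → ∃ b : ℕ, 1 ≤ b ∧ a β * (b : ℝ) < T ∧ UnivShellCond r.ρ β b n ε

/-- Universal sharp (units `a`) ⇒ I♯_SC (PROVED): one `(T, β₂)` serves every rarity budget `δ`. -/
theorem onsetSharpSC_of_univ (h : UnivOnsetSharpSC) : OnsetSharpUKPcSC := by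
  intro G _ _ _ _ hG hsc
  letI : MeasurableSpace G := borel G
  haveI : BorelSpace G := ⟨rfl⟩
  intro r a ha hat hlb
  obtain ⟨n, ε, hn, hε, hM, T, β₂, hb⟩ := h G hG hsc r a ha hat hlb
  refine ⟨n, ε, hn, hε, hM, fun δ _ => ⟨T, β₂, fun β hβ => ?_⟩⟩
  obtain ⟨b, hb1, hlt, hU⟩ := hb β hβ
  exact ⟨b, hb1, hlt, (typShellCondUKPc_iff_mirror r.ρ β b n ε δ).mpr
    (OnsetFormatsUc.typShellCondUKPc_of_univShellCond hU δ)⟩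

/-- **(1)B-sharp-universal (units `a`) ∧ R_NSC ⇒ IR (PROVED, E discharged).** -/
theorem ir_of_univOnsetSharpSC (h : UnivOnsetSharpSC) (hN : IRNSC) :
    Summit.QuantumFields.YangMills.Theses.BalabanLadder.IR :=
  ir_of_onsetSharpSC (onsetSharpSC_of_univ h) hN

/-- Units-`a` form: under the wire, (1)B-sharp-universal fails at `(G, r)` for EVERY unit map carrying `LowerBounds` — i.e. it is
refuted outright as soon as the UV side supplies one such `a` (hypothesis `hUV`). -/
theorem not_univOnsetSharpSC_of_uniformWire (G : Type) [Group G] [TopologicalSpace G] [IsTopologicalGroup G]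
    [CompactSpace G] (hG : IsCompactSimpleLieGroup G) (hsc : SimplyConnectedSpace G)
    (hW : letI : MeasurableSpace G := borel G; haveI : BorelSpace G := ⟨rfl⟩;
      ∃ r : LatticeRep G, OnsetWire.UniformWire r.ρ ∧
        ∃ a : ℝ → ℝ, (∀ β, 0 < a β) ∧ Tendsto a atTop (𝓝 0) ∧ LowerBounds G r a) : ¬ UnivOnsetSharpSC := by
  intro h
  letI : MeasurableSpace G := borel G
  haveI : BorelSpace G := ⟨rfl⟩
  obtain ⟨r, hWr, a, ha, hat, hlb⟩ := hW
  obtain ⟨n, ε, hn, hε, hM, T, β₂, hb⟩ := h G hG hsc r a ha hat hlb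
  refine OnsetWire.onsetMixingAt_false_of_uniformWire r hWr ⟨n, ε, hn, hε, shellCount_lt_one_of_le hM, β₂, ?_⟩
  intro β hβ
  obtain ⟨b, hb1, -, hU⟩ := hb β hβ
  exact ⟨b, hb1, hU⟩


/-! ## §3 (6d) The abstract hereditary activity supplier ⇒ `IR|SC` -/

/-- **(6d) Lane (1)B's relativised supplier in the FORMAT'S OWN hereditary currency (PROVED): adapter to clause (i) AT EVERY CENTRE + sharp
construction statement supplying, per mesh-`b` frame, ANY measurable cell-local class `Typ` with activities `≤ r₀ n ε` relative to `Typ`-data, clause (ii)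
in UKP form (`ClauseIIukp`: exteriors resampled-or-typical within distance `1`) and clause (iii) at budget `δ` ⇒ I♯_SC ⇒ `IR|SC` without X.  This is the shape in
which a BOUNDARY-LAYER-sensitive class (O-107 (d)) can be supplied; nothing here certifies one. -/
theorem ir_of_activitySupplierHereditarySharpSC
    (Act : ∀ {G : Type} [Group G] [TopologicalSpace G] [IsTopologicalGroup G] [CompactSpace G] [MeasurableSpace G]
      [BorelSpace G] {N : ℕ}, (G →* Matrix (Fin N) (Fin N) ℂ) → ℝ → (Fin 4 → ℤ → ℤ) → ℕ → ℝ →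
        ((Fin 4 → ℤ) → Set (LGConfig 4 G)) → Prop)
    (r₀ : ℕ → ℝ → ℝ)
    (hadapt : ∀ {G : Type} [Group G] [TopologicalSpace G] [IsTopologicalGroup G] [CompactSpace G] [MeasurableSpace G]
      [BorelSpace G] {N : ℕ} (ρ : G →* Matrix (Fin N) (Fin N) ℂ) (β : ℝ) (w : Fin 4 → ℤ → ℤ) (n : ℕ) (ε : ℝ)
      (Typ : (Fin 4 → ℤ) → Set (LGConfig 4 G)), Act ρ β w n (r₀ n ε) Typ → ClauseIAll ρ β w n ε Typ)
    (hcons : ∀ (G : Type) [Group G] [TopologicalSpace G] [IsTopologicalGroup G] [CompactSpace G],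
      IsCompactSimpleLieGroup G → SimplyConnectedSpace G →
      letI : MeasurableSpace G := borel G; haveI : BorelSpace G := ⟨rfl⟩;
      ∀ (r : LatticeRep G) (a : ℝ → ℝ), (∀ β, 0 < a β) → Tendsto a atTop (𝓝 0) → LowerBounds G r a →
        ∃ (n : ℕ) (ε : ℝ), 1 ≤ n ∧ 0 ≤ ε ∧ ε * OnsetFormats.shellCount n ≤ 3 / 4 ∧
          ∀ δ : ℝ, 0 < δ → ∃ T β₂ : ℝ, ∀ β : ℝ, β₂ ≤ β → ∃ b : ℕ, 1 ≤ b ∧ a β * (b : ℝ) < T ∧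
            ∀ w : Fin 4 → ℤ → ℤ, IsFrame b w → ∃ Typ : (Fin 4 → ℤ) → Set (LGConfig 4 G),
              TypLocal w Typ ∧ Act r.ρ β w n (r₀ n ε) Typ ∧ ClauseIIukp r.ρ β w δ Typ ∧ ClauseIII r.ρ β w b δ Typ)
    (hN : IRNSC) : Summit.QuantumFields.YangMills.Theses.BalabanLadder.IR := by
  refine ir_of_onsetSharpSC (fun G _ _ _ _ hG hsc => ?_) hN
  letI : MeasurableSpace G := borel G
  haveI : BorelSpace G := ⟨rfl⟩
  intro r a ha hat hlb
  obtain ⟨n, ε, hn, hε, hM, hrest⟩ := hcons G hG hsc r a ha hat hlb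
  refine ⟨n, ε, hn, hε, hM, fun δ hδ => ?_⟩
  obtain ⟨T, β₂, hβ⟩ := hrest δ hδ
  refine ⟨T, β₂, fun β hb => ?_⟩
  obtain ⟨b, hb1, hlt, hw⟩ := hβ β hb
  refine ⟨b, hb1, hlt, fun w hwf => ?_⟩
  obtain ⟨Typ, hloc, hact, hii, hiii⟩ := hw w hwf
  exact ⟨Typ, hloc, hadapt r.ρ β w n ε Typ hact, hii, hiii⟩


/-! ## §4 (6e) The δ-UNIFORM trap -/

/-- **(6e) The δ-UNIFORM trap.**  A supplier in the typical currency whose mesh `b(β)` and window `(T, β₂)` do NOT depend on the rarity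
budget — «∃ T β₂ ∀ β ≥ β₂ ∃ b, a β · b < T ∧ ∀ δ > 0, TypShellCondUKPc ρ β b n ε δ» — on the SC family. -/
def DeltaUniformOnsetSharpSC : Prop :=
  ∀ (G : Type) [Group G] [TopologicalSpace G] [IsTopologicalGroup G] [CompactSpace G],
    IsCompactSimpleLieGroup G → SimplyConnectedSpace G →
    letI : MeasurableSpace G := borel G; haveI : BorelSpace G := ⟨rfl⟩;
    ∀ (r : LatticeRep G) (a : ℝ → ℝ), (∀ β, 0 < a β) → Tendsto a atTop (𝓝 0) → LowerBounds G r a →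
      ∃ (n : ℕ) (ε : ℝ), 1 ≤ n ∧ 0 ≤ ε ∧ ε * OnsetFormats.shellCount n ≤ 3 / 4 ∧
        ∃ T β₂ : ℝ, ∀ β : ℝ, β₂ ≤ β → ∃ b : ℕ, 1 ≤ b ∧ a β * (b : ℝ) < T ∧
          ∀ δ : ℝ, 0 < δ → TypShellCondUKPc r.ρ β b n ε δ

/-- **(6e) A δ-uniform typical supplier HAS PROVED the universal currency (PROVED)** — INERTNESS at fixed `(β, b, n, ε)`,
`OnsetFormatsUcTransfer.forall_typShellCondUKPc_iff_univShellCond` (p503173 lineage): the typical class buys something only through the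
δ-dependence of `(b, T, β₂)`.  Hence lane (1)B's construction statement must put `δ` BEFORE `T, β₂` (as `OnsetSharpUKPcSC` does). -/
theorem univOnsetSharpSC_of_deltaUniform (h : DeltaUniformOnsetSharpSC) : UnivOnsetSharpSC := by
  intro G _ _ _ _ hG hsc
  letI : MeasurableSpace G := borel G
  haveI : BorelSpace G := ⟨rfl⟩
  intro r a ha hat hlb
  haveI : T2Space G := T2Space.of_injective_continuous r.injective r.continuous
  haveI : SecondCountableTopology G :=
    (r.continuous.isClosedEmbedding r.injective).isEmbedding.secondCountableTopology
  obtain ⟨n, ε, hn, hε, hM, T, β₂, hb⟩ := h G hG hsc r a ha hat hlb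
  refine ⟨n, ε, hn, hε, hM, T, β₂, fun β hβ => ?_⟩
  obtain ⟨b, hb1, hlt, hall⟩ := hb β hβ
  refine ⟨b, hb1, hlt, (OnsetFormatsUc.forall_typShellCondUKPc_iff_univShellCond r.continuous).mp fun δ hδ => ?_⟩
  exact (typShellCondUKPc_iff_mirror r.ρ β b n ε δ).mp (hall δ hδ)

/-- **(6e) … and is therefore EXPOSED to the uniform wire (PROVED modulo the wire)**: under `OnsetWire.UniformWire r.ρ` for one `r` of a
simply connected `G` (with one unit map carrying `LowerBounds`), no δ-uniform typical supplier exists. -/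
theorem not_deltaUniformOnsetSharpSC_of_uniformWire (G : Type) [Group G] [TopologicalSpace G] [IsTopologicalGroup G]
    [CompactSpace G] (hG : IsCompactSimpleLieGroup G) (hsc : SimplyConnectedSpace G)
    (hW : letI : MeasurableSpace G := borel G; haveI : BorelSpace G := ⟨rfl⟩;
      ∃ r : LatticeRep G, OnsetWire.UniformWire r.ρ ∧
        ∃ a : ℝ → ℝ, (∀ β, 0 < a β) ∧ Tendsto a atTop (𝓝 0) ∧ LowerBounds G r a) : ¬ DeltaUniformOnsetSharpSC :=
  fun h => not_univOnsetSharpSC_of_uniformWire G hG hsc hW (univOnsetSharpSC_of_deltaUniform h)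


/-! ## §5 The K-SM∞ hook of record (p528589 `AfPincerUc.LateOnsetAt`) on the I♯ side, and the universal-onset domination lemma -/

/-- **Late onset (p528589 currency) at EVERY admissible `(n, ε)` of one simply connected `(G, r, a)` ⇒ ¬ I♯_SC (PROVED).**  `LateOnsetAt r a n ε δ` says: for
every `T, β₁` some `β ≥ β₁` at which the format holds at some mesh but FAILS at every mesh `b ≥ 1` with `a β · b ≤ T`; I♯_SC supplies, for all large `β`, a mesh `b ≥ 1`
with `a β · b < T` at which it HOLDS.  (Contrast: `AfPincerUc.KSMInf` = late onset at ONE admissible `(n, ε, δ)` refutes X — `not_afToOnsetUKPc_of_ksmInf` — but not I♯_SC,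
whose supplier picks `(n, ε)`.)  Owner R100: `KSMInf` is the kill-world hook of record; physics grade EMPTY for simply connected `G` (cdisprove `KSM-VERDICT.md` cad25bdadf3fb41d). -/
theorem not_onsetSharpUKPcSC_of_lateOnsetAt (G : Type) [Group G] [TopologicalSpace G] [IsTopologicalGroup G]
    [CompactSpace G] (hG : IsCompactSimpleLieGroup G) (hsc : SimplyConnectedSpace G)
    (h : letI : MeasurableSpace G := borel G; haveI : BorelSpace G := ⟨rfl⟩;
      ∃ (r : LatticeRep G) (a : ℝ → ℝ), (∀ β, 0 < a β) ∧ Tendsto a atTop (𝓝 0) ∧ LowerBounds G r a ∧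
        ∀ (n : ℕ) (ε : ℝ), 1 ≤ n → 0 ≤ ε → ε * OnsetFormats.shellCount n ≤ 3 / 4 →
          ∃ δ : ℝ, 0 < δ ∧ LateOnsetAt r a n ε δ) : ¬ OnsetSharpUKPcSC := by
  letI : MeasurableSpace G := borel G
  haveI : BorelSpace G := ⟨rfl⟩
  intro hS
  obtain ⟨r, a, ha, hat, hlb, hall⟩ := h
  obtain ⟨n, ε, hn, hε, hM, hδT⟩ := hS G hG hsc r a ha hat hlb
  obtain ⟨δ, hδ, hlate⟩ := hall n ε hn hε hM
  obtain ⟨T, β₂, hb⟩ := hδT δ hδ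
  obtain ⟨β, hβ, -, hfail⟩ := hlate T β₂
  obtain ⟨b, hb1, hlt, hP⟩ := hb β hβ
  exact hfail b hb1 hlt.le hP

/-- **The universal onset dominates every typical onset (PROVED)**: if the universal format holds at some mesh `b ≥ 1` then
`mixOnsetUc ρ β n ε δ ≤ b` for EVERY `δ` (`OnsetFormatsUcTransfer.typShellCondUKPc_of_univShellCond`, class `≡ univ`).  So
«`a β ·` (universal onset) `→ ∞`» does not give `LateOnsetAt` at any fixed `δ` — a late onset argued from uniform boundary data is K-UW (uniform-wire) territory. -/
theorem mixOnsetUc_le_of_univShellCond {G : Type} [Group G] [TopologicalSpace G] [IsTopologicalGroup G] [CompactSpace G]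
    [MeasurableSpace G] [BorelSpace G] {N : ℕ} (ρ : G →* Matrix (Fin N) (Fin N) ℂ) {β : ℝ} {b : ℕ} (hb : 1 ≤ b) {n : ℕ}
    {ε : ℝ} (hU : UnivShellCond ρ β b n ε) (δ : ℝ) : mixOnsetUc ρ β n ε δ ≤ b :=
  fmtOnset_le (fun β' b => TypShellCondUKPc ρ β' b n ε δ) β hb
    ((typShellCondUKPc_iff_mirror ρ β b n ε δ).mpr (OnsetFormatsUc.typShellCondUKPc_of_univShellCond hU δ))

end Summit.QuantumFields.YangMills.Cruxes.IR.AfPincerUc.SharpOnset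

end
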